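import Summits.MatrixMultiplication.MatrixMultiplication.Theorems.FarEdgeDescentDefectWorlds
import HarnessLib

/-!
# Route `FarEdgeDescent` — the summable endpoint of the defect dial, companion: SEPARATING MODEL WORLDS
`BDD ⊋ SLD ⊋ bare residual`, and the NEXT notch (linear log-defect) does NOT carry a floor — all PROVED

decomp-mm ROOT cell (D-0178), lens 2 «structural dichotomy: special vs generic», gen 19; companion of
`FarEdgeDescentSummableDefect` (the floor under a SUMMABLE LOG-DEFECT envelope `C_i ≥ 1`,
`e(m)² ≤ C_i·(ω−2)·e(2m−1)` for `1 < m ≤ 2^i + 1`, `Σ log(C_i)/2^i < ∞` — the route aside `SummableLogDefect`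
= SLD, stmt-MatrixMultiplication-27344, route rev 11 — and the exact cuts `ω = 2 ⟺ SuperExpContact ∧ SLD ⟺
FiniteSaturation ∧ SLD`).  Notation: `e(x) := ω(1,x,1) − (x+1)`,
`w := ω − 2`; `u := x − 1` is the distance from the square.  Every statement here is about an explicit MODEL
profile `E : ℝ → ℝ` (given by a closed form `hE`; nothing is claimed about the true exponents): the worlds
say which inclusions of the dial are strict and where the halving-with-budget mechanism stops.

* §3 **`BDD ⊋ SLD` (PROVED).**  The STRETCHED world `E(x) = w·exp(−2(x−1) + (√x − 1))` of gen 18 — whose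
  doubling defect `exp(2√m − √(2m−1) − 1)` is unbounded (`FarEdgeDescentDefectWorlds.stretchWorld_not_bdd`) —
  obeys `SLD` with the envelope `C_i = exp(2·(√2)^i)`, `Σ log(C_i)/2^i = Σ 2(√2/2)^i < ∞` (`stretchWorld_sld`).
* §4 **`SLD ⊋ residual` (PROVED).**  The BREATHING world
  `E(x) = w·exp(−8u + u·sin²((π/2)·max(0, log₂ u)))`, `u = x − 1`, has a geometric floor — the residual-shape
  statement holds for it (`breathWorld_floor`) — and violates `SLD` for EVERY summable envelope: at
  `u = 2^i`, `i` odd, its doubling defect is `exp(2^{i+1})` (`breathWorld_not_sld`).  In the picture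
  `E(1+u) = w·e^{−λu − u·ψ(log₂ u)}`: a floor is `ψ` BOUNDED ABOVE, `SLD` is `Σ (Δψ)⁺ < ∞` — bounded partial
  sums versus absolute convergence.
* §5 **THE NEXT NOTCH FAILS (PROVED).**  The GAMMA world `E(x) = w·exp(−(3/2)u − u·log x)` has the
  supporting line `E(m) ≥ w − (5/2)w(m−1)` (`gammaWorld_line`), a doubling defect of LINEAR logarithm,
  `E(m)² ≤ exp(2·log 2·(m−1))·w·E(2m−1)` (`gammaWorld_linearDefect`: dyadic envelope `log C_i/2^i ≡ 2 log 2`,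
  bounded but not summable), yet SUPEREXPONENTIAL CONTACT `∀ ρ > 0 ∃ k ≥ 2, E(k) < ρ^k` (`gammaWorld_contact`)
  — no exponential floor — and it violates `SLD` (`gammaWorld_not_sld`).  So in the engine
  `FarEdgeDescentSummableDefect.exp_floor_summable` the summability of `log(C_i)/2^i` cannot be relaxed to
  boundedness: `ℓ¹` is the threshold of the halving mechanism, and `SLD` is the endpoint of this dial.

[cite: LottiRomani1983, §1 (p. 173), §2 (p. 174)] [cite: Coppersmith1982] [cite: HuangPan1998, §8]
-/

set_option linter.dupNamespace false

noncomputable section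

namespace Summit.MatrixMultiplication.MatrixMultiplication.Theorems.FarEdgeDescentSummableWorlds

open Summit.MatrixMultiplication.MatrixMultiplication.Theorems.FarEdgeDescentExpFloor
open Summit.MatrixMultiplication.MatrixMultiplication.Theorems.FarEdgeDescentDefectWorlds

/-- Defect bookkeeping for exponential model profiles: `(w·e^A)² ≤ C·w·(w·e^B)` as soon as
`e^{2A−B} ≤ C` (`w ≥ 0`). -/
theorem defect_le_of_exp {w C A B : ℝ} (hw : 0 ≤ w) (h : Real.exp (2 * A - B) ≤ C) :
    (w * Real.exp A) ^ 2 ≤ C * w * (w * Real.exp B) := by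
  have e1 : Real.exp A ^ 2 = Real.exp (2 * A - B) * Real.exp B := by
    rw [← Real.exp_add, ← Real.exp_nat_mul]
    congr 1
    push_cast
    ring
  have hB := Real.exp_pos B
  calc (w * Real.exp A) ^ 2 = Real.exp (2 * A - B) * w * (w * Real.exp B) := by rw [mul_pow, e1]; ring
    _ ≤ C * w * (w * Real.exp B) :=
        mul_le_mul_of_nonneg_right (mul_le_mul_of_nonneg_right h hw) (mul_nonneg hw hB.le)

/-! ## §3 `BDD ⊋ SLD`: the stretched world has a summable log-defect -/

/-- **The stretched world obeys SLD (PROVED).**  `E(x) = w·exp(−2(x−1) + (√x − 1))` (unbounded doubling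
defect, `stretchWorld_not_bdd`) satisfies the summable-envelope law with `C_i = exp(2(√2)^i)`:
`2√m − √(2m−1) − 1 ≤ 2√m − 2 ≤ 2(√2)^i` for `m ≤ 2^i + 1`, and `Σ 2(√2)^i/2^i < ∞`. -/
theorem stretchWorld_sld {w : ℝ} (hw : 0 < w) :
    ∃ C : ℕ → ℝ, (∀ i, 1 ≤ C i) ∧ Summable (fun i : ℕ => Real.log (C i) / 2 ^ i) ∧
      ∀ (i : ℕ) (m : ℝ), 1 < m → m ≤ 2 ^ i + 1 →
        (w * Real.exp (-(2 * (m - 1)) + (Real.sqrt m - 1))) ^ 2 ≤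
          C i * w * (w * Real.exp (-(2 * ((2 * m - 1) - 1)) + (Real.sqrt (2 * m - 1) - 1))) := by
  refine ⟨fun i => Real.exp (2 * Real.sqrt 2 ^ i), fun i => Real.one_le_exp (by positivity), ?_,
    fun i m hm hmi => ?_⟩
  · have e : (fun i : ℕ => Real.log (Real.exp (2 * Real.sqrt 2 ^ i)) / 2 ^ i) =
        fun i : ℕ => 2 * (Real.sqrt 2 / 2) ^ i := by
      funext i
      rw [Real.log_exp, div_pow, mul_div_assoc]
    rw [e]
    refine (summable_geometric_of_lt_one (by positivity) ?_).mul_left 2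
    rw [div_lt_one two_pos, Real.sqrt_lt' two_pos]
    norm_num
  · beta_reduce
    apply defect_le_of_exp hw.le
    rw [Real.exp_le_exp]
    have h1 : 1 ≤ Real.sqrt (2 * m - 1) :=
      calc (1 : ℝ) = Real.sqrt 1 := Real.sqrt_one.symm
        _ ≤ Real.sqrt (2 * m - 1) := Real.sqrt_le_sqrt (by linarith)
    have hs2 : Real.sqrt 2 ^ 2 = 2 := Real.sq_sqrt (by norm_num)
    have hpow : (Real.sqrt 2 ^ i) ^ 2 = 2 ^ i := by rw [← pow_mul, mul_comm, pow_mul, hs2]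
    have hnn : 0 ≤ Real.sqrt 2 ^ i := pow_nonneg (Real.sqrt_nonneg 2) i
    have h2 : Real.sqrt m ≤ Real.sqrt 2 ^ i + 1 := by
      rw [show Real.sqrt 2 ^ i + 1 = Real.sqrt ((Real.sqrt 2 ^ i + 1) ^ 2) from
        (Real.sqrt_sq (by positivity)).symm]
      exact Real.sqrt_le_sqrt (by nlinarith [hpow, hnn])
    linarith [h1, h2]

/-! ## §4 `SLD ⊋ residual`: the breathing world — geometric floor, no summable envelope -/

/-- **The breathing world has a geometric floor (PROVED).**
`E(x) = w·exp(−8(x−1) + (x−1)·sin²((π/2)·max(0, log₂(x−1)))) ≥ w·e^{−8(x−1)}`, hence `∃ ρ > 0, E(k) ≥ ρ^k`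
for all `k ≥ 2` — the residual-shape statement (`residual_iff_expFloorLaw`) holds in this world. -/
theorem breathWorld_floor {w : ℝ} (hw : 0 < w) {E : ℝ → ℝ}
    (hE : ∀ x, E x = w * Real.exp (-8 * (x - 1) +
      (x - 1) * Real.sin (Real.pi / 2 * max 0 (Real.logb 2 (x - 1))) ^ 2)) :
    ∃ ρ : ℝ, 0 < ρ ∧ ∀ k : ℕ, 2 ≤ k → ρ ^ k ≤ E k := by
  refine ⟨Real.exp (-8) * min 1 w, mul_pos (Real.exp_pos _) (lt_min one_pos hw), fun k hk => ?_⟩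
  refine (geom_le_expProfile hw (by norm_num : (0 : ℝ) ≤ 8) (k := k) (by omega)).trans ?_
  rw [hE]
  apply mul_le_mul_of_nonneg_left _ hw.le
  rw [Real.exp_le_exp]
  have hk1 : (0 : ℝ) ≤ (k : ℝ) - 1 := by
    have : (2 : ℝ) ≤ k := by exact_mod_cast hk
    linarith
  nlinarith [mul_nonneg hk1 (sq_nonneg (Real.sin (Real.pi / 2 * max 0 (Real.logb 2 ((k : ℝ) - 1)))))]

/-- **The breathing world violates SLD for EVERY summable envelope (PROVED).**  If `Σ log(C_i)/2^i < ∞`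
then `log(C_i)/2^i → 0`; at an odd index `i` with `log(C_i)/2^i < 2` and the shape `m = 1 + 2^i`
(`sin² = 1` at `log₂ u = i`, `sin² = 0` at `log₂(2u) = i+1`) the doubling defect is `exp(2^{i+1}) > C_i`. -/
theorem breathWorld_not_sld {w : ℝ} (hw : 0 < w) {E : ℝ → ℝ}
    (hE : ∀ x, E x = w * Real.exp (-8 * (x - 1) +
      (x - 1) * Real.sin (Real.pi / 2 * max 0 (Real.logb 2 (x - 1))) ^ 2))
    (C : ℕ → ℝ) (hS : Summable (fun i : ℕ => Real.log (C i) / 2 ^ i)) :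
    ∃ (i : ℕ) (m : ℝ), 1 < m ∧ m ≤ 2 ^ i + 1 ∧ C i * w * E (2 * m - 1) < E m ^ 2 := by
  obtain ⟨i₀, hi₀⟩ := Filter.eventually_atTop.1
    (hS.tendsto_atTop_zero.eventually (gt_mem_nhds (by norm_num : (0 : ℝ) < 2)))
  -- the witness at a general index `i` with small envelope and the right phases
  have main : ∀ i : ℕ, Real.log (C i) / 2 ^ i < 2 → Real.sin (Real.pi / 2 * (i : ℝ)) ^ 2 = 1 →
      Real.sin (Real.pi / 2 * ((i : ℝ) + 1)) ^ 2 = 0 →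
      C i * w * E (2 * (1 + 2 ^ i) - 1) < E (1 + 2 ^ i) ^ 2 := by
    intro i hi hs1 hs0
    have h2i : (0 : ℝ) < 2 ^ i := pow_pos two_pos i
    have e1 : (1 : ℝ) + 2 ^ i - 1 = 2 ^ i := by ring
    have e2 : (2 : ℝ) * (1 + 2 ^ i) - 1 - 1 = 2 ^ (i + 1) := by ring
    have hlb1 : max 0 (Real.logb 2 ((2 : ℝ) ^ i)) = (i : ℝ) := by
      rw [Real.logb_pow, Real.logb_self_eq_one one_lt_two, mul_one, max_eq_right (Nat.cast_nonneg i)]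
    have hlb2 : max 0 (Real.logb 2 ((2 : ℝ) ^ (i + 1))) = (i : ℝ) + 1 := by
      rw [Real.logb_pow, Real.logb_self_eq_one one_lt_two, mul_one, max_eq_right (Nat.cast_nonneg _)]
      push_cast
      ring
    rw [hE, hE, e2, e1, hlb1, hlb2, hs1, hs0]
    apply defect_witness_of_exp hw
    have e3 : 2 * (-8 * (2 : ℝ) ^ i + 2 ^ i * 1) - (-8 * 2 ^ (i + 1) + 2 ^ (i + 1) * 0) = 2 * 2 ^ i := by
      ring
    rw [e3]
    rcases le_or_gt (C i) 0 with hC0 | hC0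
    · exact hC0.trans_lt (Real.exp_pos _)
    · rw [← Real.log_lt_iff_lt_exp hC0]
      rw [div_lt_iff₀ h2i] at hi
      linarith
  refine ⟨2 * i₀ + 1, 1 + 2 ^ (2 * i₀ + 1), by have := pow_pos (two_pos : (0 : ℝ) < 2) (2 * i₀ + 1); linarith,
    le_of_eq (by ring), main _ (hi₀ _ (by omega)) ?_ ?_⟩
  · have e : Real.pi / 2 * ((2 * i₀ + 1 : ℕ) : ℝ) = Real.pi / 2 + (i₀ : ℝ) * Real.pi := by
      push_cast
      ring
    rw [e, Real.sin_add_nat_mul_pi, Real.sin_pi_div_two, mul_one, ← pow_mul, mul_comm, pow_mul,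
      neg_one_sq, one_pow]
  · have e : Real.pi / 2 * (((2 * i₀ + 1 : ℕ) : ℝ) + 1) = ((i₀ + 1 : ℕ) : ℝ) * Real.pi := by
      push_cast
      ring
    rw [e, Real.sin_nat_mul_pi]
    norm_num

/-! ## §5 The next notch fails: the gamma world — linear log-defect, no floor -/

/-- **Supporting line of the gamma world (PROVED).**  `E(x) = w·exp(−(3/2)(x−1) − (x−1)·log x)` satisfies
`E(m) ≥ w − (5/2)w(m−1)` on `[1,∞)` (`e^g ≥ 1+g`, `log m ≤ m−1`). -/
theorem gammaWorld_line {w : ℝ} (hw : 0 < w) {E : ℝ → ℝ}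
    (hE : ∀ x, E x = w * Real.exp (-(3 / 2) * (x - 1) - (x - 1) * Real.log x)) :
    ∀ m : ℝ, 1 ≤ m → w - 5 / 2 * w * (m - 1) ≤ E m := by
  intro m hm
  rw [hE]
  have hexp := Real.exp_pos (-(3 / 2) * (m - 1) - (m - 1) * Real.log m)
  rcases le_or_gt 1 (m - 1) with hu | hu
  · nlinarith
  · have hu0 : 0 ≤ m - 1 := by linarith
    have hlog : Real.log m ≤ m - 1 := Real.log_le_sub_one_of_pos (by linarith)
    have hg : -(3 / 2) * (m - 1) - (m - 1) * Real.log m + 1 ≤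
        Real.exp (-(3 / 2) * (m - 1) - (m - 1) * Real.log m) := Real.add_one_le_exp _
    have A := mul_le_mul_of_nonneg_left hg hw.le
    have B : w * ((m - 1) * Real.log m) ≤ w * ((m - 1) * (m - 1)) :=
      mul_le_mul_of_nonneg_left (mul_le_mul_of_nonneg_left hlog hu0) hw.le
    have C' : w * ((m - 1) * (m - 1)) ≤ w * (m - 1) :=
      mul_le_mul_of_nonneg_left (by nlinarith) hw.le
    linarith

/-- **Linear log-defect of the gamma world (PROVED).**  `E(m)² ≤ exp(2·log 2·(m−1))·w·E(2m−1)` for every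
`m > 1`: `2A − B = 2(m−1)(log(2m−1) − log m) ≤ 2(m−1)·log 2`.  In the dyadic envelope this is
`log C_i / 2^i ≡ 2 log 2` — bounded, NOT summable. -/
theorem gammaWorld_linearDefect {w : ℝ} (hw : 0 < w) {E : ℝ → ℝ}
    (hE : ∀ x, E x = w * Real.exp (-(3 / 2) * (x - 1) - (x - 1) * Real.log x)) :
    ∀ m : ℝ, 1 < m → E m ^ 2 ≤ Real.exp (2 * Real.log 2 * (m - 1)) * w * E (2 * m - 1) := by
  intro m hm
  rw [hE, hE]
  apply defect_le_of_exp hw.le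
  rw [Real.exp_le_exp]
  have hlog : Real.log (2 * m - 1) ≤ Real.log 2 + Real.log m := by
    rw [← Real.log_mul two_ne_zero (by linarith : m ≠ 0)]
    exact Real.log_le_log (by linarith) (by linarith)
  nlinarith [mul_nonneg (sub_nonneg.2 hm.le) (sub_nonneg.2 hlog)]

/-- **Superexponential contact of the gamma world (PROVED): no exponential floor.**  For every `ρ > 0`
there is an integer `k ≥ 2` with `E(k) < ρ^k` (take `log k > 2|log ρ| + |log w| + 2`). -/
theorem gammaWorld_contact {w : ℝ} (hw : 0 < w) {E : ℝ → ℝ}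
    (hE : ∀ x, E x = w * Real.exp (-(3 / 2) * (x - 1) - (x - 1) * Real.log x)) :
    ∀ ρ : ℝ, 0 < ρ → ∃ k : ℕ, 2 ≤ k ∧ E k < ρ ^ k := by
  intro ρ hρ
  obtain ⟨k, hk⟩ := exists_nat_gt (max (Real.exp (2 * |Real.log ρ| + |Real.log w| + 2)) 2)
  have hk2 : (2 : ℝ) < k := (le_max_right _ _).trans_lt hk
  have hkT : Real.exp (2 * |Real.log ρ| + |Real.log w| + 2) < k := (le_max_left _ _).trans_lt hk
  have hk2' : 2 ≤ k := by exact_mod_cast hk2.le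
  refine ⟨k, hk2', ?_⟩
  have hkpos : (0 : ℝ) < k := by linarith
  have hlogk : 2 * |Real.log ρ| + |Real.log w| + 2 < Real.log k := by
    have := Real.log_lt_log (Real.exp_pos _) hkT
    rwa [Real.log_exp] at this
  have hρk : ρ ^ k = Real.exp ((k : ℝ) * Real.log ρ) := by rw [Real.exp_nat_mul, Real.exp_log hρ]
  have hwexp : w = Real.exp (Real.log w) := (Real.exp_log hw).symm
  rw [hE, hρk, hwexp, ← Real.exp_add, Real.exp_lt_exp]
  have hT0 : 0 ≤ 2 * |Real.log ρ| + |Real.log w| + 2 := by positivity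
  have h3 : ((k : ℝ) / 2) * (2 * |Real.log ρ| + |Real.log w| + 2) ≤ ((k : ℝ) - 1) * Real.log k :=
    mul_le_mul (by linarith) hlogk.le hT0 (by linarith)
  have h4 : (k : ℝ) * -|Real.log ρ| ≤ (k : ℝ) * Real.log ρ :=
    mul_le_mul_of_nonneg_left (neg_abs_le _) hkpos.le
  have h5 : |Real.log w| + 2 ≤ (k : ℝ) / 2 * (|Real.log w| + 2) :=
    le_mul_of_one_le_left (by positivity) (by linarith)
  linarith [le_abs_self (Real.log w), h3, h4, h5]

/-- **The gamma world violates SLD (PROVED).**  At `u = 2^i` its doubling defect is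
`exp(2u·log((2u+1)/(u+1))) ≥ exp(2u·log(3/2))`, so a valid envelope has `log(C_i)/2^i ≥ 2·log(3/2)` for
all `i` — never summable (indeed never `→ 0`). -/
theorem gammaWorld_not_sld {w : ℝ} (hw : 0 < w) {E : ℝ → ℝ}
    (hE : ∀ x, E x = w * Real.exp (-(3 / 2) * (x - 1) - (x - 1) * Real.log x))
    (C : ℕ → ℝ) (hS : Summable (fun i : ℕ => Real.log (C i) / 2 ^ i)) :
    ∃ (i : ℕ) (m : ℝ), 1 < m ∧ m ≤ 2 ^ i + 1 ∧ C i * w * E (2 * m - 1) < E m ^ 2 := by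
  have ht : (0 : ℝ) < Real.log (3 / 2) := Real.log_pos (by norm_num)
  obtain ⟨i, hi⟩ := Filter.eventually_atTop.1 (hS.tendsto_atTop_zero.eventually (gt_mem_nhds ht))
  have hi := hi i le_rfl
  have h2i : (0 : ℝ) < 2 ^ i := pow_pos two_pos i
  have h1i : (1 : ℝ) ≤ 2 ^ i := one_le_pow₀ one_le_two
  refine ⟨i, 1 + 2 ^ i, by linarith, le_of_eq (by ring), ?_⟩
  have e1 : (1 : ℝ) + 2 ^ i - 1 = 2 ^ i := by ring
  have e2 : (2 : ℝ) * (1 + 2 ^ i) - 1 - 1 = 2 * 2 ^ i := by ring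
  have e3 : (2 : ℝ) * (1 + 2 ^ i) - 1 = 2 * 2 ^ i + 1 := by ring
  rw [hE, hE, e2, e3, e1]
  apply defect_witness_of_exp hw
  have hlow : Real.log (3 / 2) + Real.log (1 + 2 ^ i) ≤ Real.log (2 * 2 ^ i + 1) := by
    rw [← Real.log_mul (by norm_num) (by linarith)]
    exact Real.log_le_log (by positivity) (by linarith)
  rcases le_or_gt (C i) 0 with hC0 | hC0
  · exact hC0.trans_lt (Real.exp_pos _)
  · rw [← Real.log_lt_iff_lt_exp hC0]
    rw [div_lt_iff₀ h2i] at hi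
    have h6 : (2 : ℝ) ^ i * Real.log (3 / 2) ≤
        2 ^ i * (Real.log (2 * 2 ^ i + 1) - Real.log (1 + 2 ^ i)) :=
      mul_le_mul_of_nonneg_left (by linarith) h2i.le
    have h7 : 0 ≤ (2 : ℝ) ^ i * (Real.log (2 * 2 ^ i + 1) - Real.log (1 + 2 ^ i)) :=
      mul_nonneg h2i.le (by linarith)
    linarith

/-- **THE `ℓ¹` THRESHOLD OF THE ENGINE IS SHARP (PROVED).**  For every anchor value `w > 0` there is a
profile with a supporting line `E(m) ≥ w − s(m−1)`, an envelope law `E(m)² ≤ C_i·w·E(2m−1)` on the dyadic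
windows with `C_i ≥ 1` and `log(C_i)/2^i ≤ 2·log 2` for ALL `i` (bounded — the hypothesis of
`FarEdgeDescentSummableDefect.exp_floor_summable` with `Σ` replaced by `sup`), and NO exponential floor:
`∀ ρ > 0 ∃ k ≥ 2, E(k) < ρ^k`.  (The gamma world, `s = (5/2)w`, `C_i = exp(2·log 2·2^i)`.) -/
theorem engine_threshold_sharp {w : ℝ} (hw : 0 < w) :
    ∃ (E : ℝ → ℝ) (s : ℝ) (C : ℕ → ℝ), 0 ≤ s ∧ (∀ i, 1 ≤ C i) ∧
      (∀ i, Real.log (C i) / 2 ^ i ≤ 2 * Real.log 2) ∧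
      (∀ m : ℝ, 1 ≤ m → w - s * (m - 1) ≤ E m) ∧
      (∀ (i : ℕ) (m : ℝ), 1 < m → m ≤ 2 ^ i + 1 → E m ^ 2 ≤ C i * w * E (2 * m - 1)) ∧
      ∀ ρ : ℝ, 0 < ρ → ∃ k : ℕ, 2 ≤ k ∧ E k < ρ ^ k := by
  have hl2 : 0 < Real.log 2 := Real.log_pos one_lt_two
  refine ⟨fun x => w * Real.exp (-(3 / 2) * (x - 1) - (x - 1) * Real.log x), 5 / 2 * w,
    fun i => Real.exp (2 * Real.log 2 * 2 ^ i), by positivity, fun i => Real.one_le_exp (by positivity),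
    fun i => ?_, ?_, fun i m hm hmi => ?_, ?_⟩
  · rw [Real.log_exp, mul_div_assoc, div_self (pow_pos two_pos i).ne', mul_one]
  · exact gammaWorld_line hw (E := fun x => w * Real.exp (-(3 / 2) * (x - 1) - (x - 1) * Real.log x))
      (fun _ => rfl)
  · have h := gammaWorld_linearDefect hw
      (E := fun x => w * Real.exp (-(3 / 2) * (x - 1) - (x - 1) * Real.log x)) (fun _ => rfl) m hm
    refine h.trans (mul_le_mul_of_nonneg_right (mul_le_mul_of_nonneg_right ?_ hw.le)
      (mul_nonneg hw.le (Real.exp_pos _).le))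
    rw [Real.exp_le_exp]
    nlinarith
  · exact gammaWorld_contact hw
      (E := fun x => w * Real.exp (-(3 / 2) * (x - 1) - (x - 1) * Real.log x)) (fun _ => rfl)

end Summit.MatrixMultiplication.MatrixMultiplication.Theorems.FarEdgeDescentSummableWorlds
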